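import Summits.Ventures.CertifiedQuantumChemistry.Rows.HubbardRingTVHoppingSign
import Summits.Ventures.CertifiedQuantumChemistry.Rows.SectorEnergyConcavity
import HarnessLib

/-!
# Ventures/CertifiedQuantumChemistry — Rows/HubbardRingTVHoppingMonotone.lean: on an even ring
# `E₀`, `OPT_DQG` and `OPT_DQG+S²` are NON-INCREASING in `|t|` — more hopping, of either sign, lowers the
# exact energy and both two-positivity lower bounds

HONEST FRAMING (verbatim): certified bounds for a stated model Hamiltonian in a stated basis; not a
claim about the real molecule beyond that model.

Seat rdm-B, ROWS courtesy file (theorems only; no `def`, no notation, no instance; zero compute). The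
three geometric facts of `run/shared/lean/pub/pub-qchem/STRUCTURE.md` §2.2.8 (i)(a)(b) about the
relaxation value as a function of the couplings — CONCAVE along every line in table space
(`Rows/RelaxationValueConcavity.lean`, `Rows/SectorEnergyConcavity.lean`), EVEN in the hopping on an
even ring (`Rows/HubbardRingTVHoppingSign.lean`) — combine to a MONOTONICITY statement: a concave even
function of one real variable is maximal at `0` and non-increasing in the absolute value of its
argument. Here, along the hopping line `t ↦ hubbardRingTV L t U` at fixed `U`:

* §1 `HoppingMonotone.h_tpencil` / `eri_tpencil` / `ecore_tpencil` — the TV-H tables are a pencil in `t`: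
  `T(t, U) = T(0, U) + t·T(1, 0)` (as complex tables); `pqgSectorEnergy_tpencil`,
  `pqgSingletEnergy_tpencil`, `energy_tpencil` — the model's values at rational `t` are the values of
  the concave real-line functions of the concavity files at `s = t`;
* §2 `le_of_concaveOn_univ_of_neg_eq` — a concave function on `ℝ` with `f (−y) = f y` satisfies
  `f y ≤ f x` for `0 ≤ x ≤ y` (`x` is a convex combination of `±y`);
* §3 **`hubbardRingTV_energy_anti_abs`**, **`hubbardRingTV_pqgSectorEnergy_anti_abs`**,
  **`hubbardRingTV_pqgSingletEnergy_anti_abs`** — for `Even L`, sectors `a, b ≤ L` (resp. `n ≤ L`) and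
  `|t₁| ≤ |t₂|`: `X(hubbardRingTV L t₂ U) ≤ X(hubbardRingTV L t₁ U)` for
  `X ∈ {E₀(·; a, b), OPT_DQG(·; a, b), OPT_DQG+S²(·; n)}`; in particular every one of them is
  `≤` its value at `t = 0` (`…_le_zero_hopping`) and, in the unit form of
  `Rows/HubbardRingTVScaleHomogeneity.lean`, the dimensionless `f_X(x) = OPT_X(L; x, 1)` of
  STRUCTURE §2.2.7 is even and non-increasing in `|x|`.

READING: statements about the ABSTRACT programme values and the exact energy of the cell's own model
object; no certificate, row, hint, claim node or value of record depends on them; the conjecture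
leaves are imported (through `Rows/HubbardRingTVHoppingSign.lean`) for the SPELLING only; no sign,
monotonicity or convergence statement about the GAP `E₀ − OPT_X` (a difference of two such functions)
is made or implied. Everything is PROVED (0 sorry, standard axioms).

References: E. H. Lieb, Phys. Rev. Lett. 62 (1989) 1201 (the bipartite sign gauge); D. A. Mazziotti,
Adv. Chem. Phys. 134 (2007) ch. 3 §II.A (the functional is linear in the reduced Hamiltonian).
Tree (REUSED): `concaveOn_pqgSectorEnergy_line`, `concaveOn_pqgSingletEnergy_line`
(`Rows/RelaxationValueConcavity`); `concaveOn_sectorGroundEnergy_line` (`Rows/SectorEnergyConcavity`);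
`hubbardRingTV_energy_neg_hopping`, `hubbardRingTV_pqg{Sector,Singlet}Energy_neg_hopping`
(`Rows/HubbardRingTVHoppingSign`); `Model.energy`, `Model.pqgSectorEnergy`, `Model.pqgSingletEnergy`.
-/

noncomputable section

namespace Summit.Ventures.CertifiedQuantumChemistry

open Matrix Finset
open Literature.MathematicalPhysics.QuantumLattice Literature.MathematicalPhysics.QuantumChemistry
open Summit.Ventures.CertifiedQuantumChemistry.Hamiltonians
open scoped ComplexOrder

/-! ## §1 The hopping pencil `T(t, U) = T(0, U) + t·T(1, 0)` and the model's values on it -/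

namespace HoppingMonotone

/-- The one-electron table is a pencil in `t`: `h(t, U) = h(0, U) + t·h(1, 0)` (`h(0, U) = 0`,
`h(1, 0) = −A`). -/
theorem h_tpencil (L : ℕ) (U t : ℚ) :
    (fun p q => (((hubbardRingTV L t U).h p q : ℚ) : ℂ)) =
      (fun p q => (((hubbardRingTV L 0 U).h p q : ℚ) : ℂ)) +
        ((t : ℝ) : ℂ) • fun p q => (((hubbardRingTV L 1 0).h p q : ℚ) : ℂ) := by
  funext p q
  simp only [hubbardRingTV, Pi.add_apply, Pi.smul_apply, smul_eq_mul, Complex.ofReal_ratCast]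
  split_ifs <;> push_cast <;> ring

/-- The two-electron table is a pencil in `t`: `(pq|rs)(t, U) = (pq|rs)(0, U) + t·(pq|rs)(1, 0)`
(`(pq|rs)(1, 0) = 0`: it does not depend on `t`). -/
theorem eri_tpencil (L : ℕ) (U t : ℚ) :
    (fun p q r s => (((hubbardRingTV L t U).eri p q r s : ℚ) : ℂ)) =
      (fun p q r s => (((hubbardRingTV L 0 U).eri p q r s : ℚ) : ℂ)) +
        ((t : ℝ) : ℂ) • fun p q r s => (((hubbardRingTV L 1 0).eri p q r s : ℚ) : ℂ) := by
  funext p q r s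
  simp only [hubbardRingTV, Pi.add_apply, Pi.smul_apply, smul_eq_mul, Complex.ofReal_ratCast]
  split_ifs <;> push_cast <;> ring

/-- The constants: `0 = 0 + t·0`. -/
theorem ecore_tpencil (L : ℕ) (U t : ℚ) :
    (((hubbardRingTV L t U).ecore : ℚ) : ℂ) =
      (((hubbardRingTV L 0 U).ecore : ℚ) : ℂ) + ((t : ℝ) : ℂ) * (((hubbardRingTV L 1 0).ecore : ℚ) : ℂ) := by
  simp [hubbardRingTV]

/-- The model's `S_z`-sector DQG value at rational `t` is the hopping-pencil value at `s = t`. -/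
theorem pqgSectorEnergy_tpencil (L : ℕ) (U t : ℚ) (a b : ℕ) :
    Model.pqgSectorEnergy (hubbardRingTV L t U) a b =
      pqgSectorEnergy
        ((fun p q => (((hubbardRingTV L 0 U).h p q : ℚ) : ℂ)) +
          ((t : ℝ) : ℂ) • fun p q => (((hubbardRingTV L 1 0).h p q : ℚ) : ℂ))
        ((fun p q r s => (((hubbardRingTV L 0 U).eri p q r s : ℚ) : ℂ)) +
          ((t : ℝ) : ℂ) • fun p q r s => (((hubbardRingTV L 1 0).eri p q r s : ℚ) : ℂ))
        ((((hubbardRingTV L 0 U).ecore : ℚ) : ℂ) + ((t : ℝ) : ℂ) * (((hubbardRingTV L 1 0).ecore : ℚ) : ℂ))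
        a b := by
  unfold Model.pqgSectorEnergy
  rw [h_tpencil, eri_tpencil, ecore_tpencil]

/-- The model's singlet-restricted DQG value at rational `t` is the hopping-pencil value at `s = t`. -/
theorem pqgSingletEnergy_tpencil (L : ℕ) (U t : ℚ) (n : ℕ) :
    Model.pqgSingletEnergy (hubbardRingTV L t U) n =
      pqgSingletEnergy
        ((fun p q => (((hubbardRingTV L 0 U).h p q : ℚ) : ℂ)) +
          ((t : ℝ) : ℂ) • fun p q => (((hubbardRingTV L 1 0).h p q : ℚ) : ℂ))
        ((fun p q r s => (((hubbardRingTV L 0 U).eri p q r s : ℚ) : ℂ)) +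
          ((t : ℝ) : ℂ) • fun p q r s => (((hubbardRingTV L 1 0).eri p q r s : ℚ) : ℂ))
        ((((hubbardRingTV L 0 U).ecore : ℚ) : ℂ) + ((t : ℝ) : ℂ) * (((hubbardRingTV L 1 0).ecore : ℚ) : ℂ))
        n := by
  unfold Model.pqgSingletEnergy
  rw [h_tpencil, eri_tpencil, ecore_tpencil]

/-- The model's exact sector energy at rational `t` is the hopping-pencil value at `s = t`. -/
theorem energy_tpencil (L : ℕ) (U t : ℚ) (a b : ℕ) :
    Model.energy (hubbardRingTV L t U) a b =
      sectorGroundEnergy (molecularHamiltonian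
        ((fun p q => (((hubbardRingTV L 0 U).h p q : ℚ) : ℂ)) +
          ((t : ℝ) : ℂ) • fun p q => (((hubbardRingTV L 1 0).h p q : ℚ) : ℂ))
        ((fun p q r s => (((hubbardRingTV L 0 U).eri p q r s : ℚ) : ℂ)) +
          ((t : ℝ) : ℂ) • fun p q r s => (((hubbardRingTV L 1 0).eri p q r s : ℚ) : ℂ))
        ((((hubbardRingTV L 0 U).ecore : ℚ) : ℂ) + ((t : ℝ) : ℂ) * (((hubbardRingTV L 1 0).ecore : ℚ) : ℂ)))
        a b := by
  unfold Model.energy Model.hamiltonian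
  rw [h_tpencil, eri_tpencil, ecore_tpencil]

end HoppingMonotone

open HoppingMonotone

/-! ## §2 A concave function with `f (−y) = f y` is non-increasing in `|·|` -/

/-- **A concave function on `ℝ` with `f (−y) = f y` has `f y ≤ f x` whenever `0 ≤ x ≤ y`**: `x` is the
convex combination `a·(−y) + b·y` with `a = (y − x)/2y`, `b = (y + x)/2y`. -/
theorem le_of_concaveOn_univ_of_neg_eq {f : ℝ → ℝ} (hf : ConcaveOn ℝ Set.univ f) {x y : ℝ}
    (hx : 0 ≤ x) (hxy : x ≤ y) (heven : f (-y) = f y) : f y ≤ f x := by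
  rcases eq_or_lt_of_le (hx.trans hxy) with hy | hy
  · have hx0 : x = 0 := le_antisymm (hxy.trans hy.symm.le) hx
    rw [hx0, ← hy]
  · have ha : 0 ≤ (y - x) / (2 * y) := div_nonneg (sub_nonneg.2 hxy) (by positivity)
    have hb : 0 ≤ (y + x) / (2 * y) := div_nonneg (by linarith) (by positivity)
    have hab : (y - x) / (2 * y) + (y + x) / (2 * y) = 1 := by
      field_simp
      ring
    have hcomb : (y - x) / (2 * y) * (-y) + (y + x) / (2 * y) * y = x := by
      field_simp
      ring
    have h := hf.2 (Set.mem_univ (-y)) (Set.mem_univ y) ha hb hab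
    simp only [smul_eq_mul] at h
    rw [hcomb, heven, ← add_mul, hab, one_mul] at h
    exact h

/-! ## §3 `E₀`, `OPT_DQG`, `OPT_DQG+S²` are non-increasing in `|t|` on an even ring -/

/-- `OPT_DQG(hubbardRingTV L |t| U) = OPT_DQG(hubbardRingTV L t U)` on an even ring. -/
theorem hubbardRingTV_pqgSectorEnergy_abs_hopping {L : ℕ} (hL : Even L) (t U : ℚ) (a b : ℕ) :
    Model.pqgSectorEnergy (hubbardRingTV L |t| U) a b = Model.pqgSectorEnergy (hubbardRingTV L t U) a b := by
  rcases le_or_gt 0 t with ht | ht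
  · rw [abs_of_nonneg ht]
  · rw [abs_of_neg ht, hubbardRingTV_pqgSectorEnergy_neg_hopping hL]

/-- `OPT_DQG+S²(hubbardRingTV L |t| U) = OPT_DQG+S²(hubbardRingTV L t U)` on an even ring. -/
theorem hubbardRingTV_pqgSingletEnergy_abs_hopping {L : ℕ} (hL : Even L) (t U : ℚ) (n : ℕ) :
    Model.pqgSingletEnergy (hubbardRingTV L |t| U) n = Model.pqgSingletEnergy (hubbardRingTV L t U) n := by
  rcases le_or_gt 0 t with ht | ht
  · rw [abs_of_nonneg ht]
  · rw [abs_of_neg ht, hubbardRingTV_pqgSingletEnergy_neg_hopping hL]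

/-- `E₀(hubbardRingTV L |t| U) = E₀(hubbardRingTV L t U)` on an even ring. -/
theorem hubbardRingTV_energy_abs_hopping {L : ℕ} (hL : Even L) (t U : ℚ) (a b : ℕ) :
    Model.energy (hubbardRingTV L |t| U) a b = Model.energy (hubbardRingTV L t U) a b := by
  rcases le_or_gt 0 t with ht | ht
  · rw [abs_of_nonneg ht]
  · rw [abs_of_neg ht, hubbardRingTV_energy_neg_hopping hL]

/-- **THE `S_z`-SECTOR DQG LOWER BOUND OF AN EVEN RING IS NON-INCREASING IN `|t|`**: for `Even L`,
`a, b ≤ L` and `|t₁| ≤ |t₂|`, `OPT_DQG(hubbardRingTV L t₂ U; a, b) ≤ OPT_DQG(hubbardRingTV L t₁ U; a, b)`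
(concave along the hopping line, even in `t`). -/
theorem hubbardRingTV_pqgSectorEnergy_anti_abs {L : ℕ} (hL : Even L) {a b : ℕ} (ha : a ≤ L) (hb : b ≤ L)
    (U : ℚ) {t₁ t₂ : ℚ} (h12 : |t₁| ≤ |t₂|) :
    Model.pqgSectorEnergy (hubbardRingTV L t₂ U) a b ≤ Model.pqgSectorEnergy (hubbardRingTV L t₁ U) a b := by
  rw [← hubbardRingTV_pqgSectorEnergy_abs_hopping hL t₁, ← hubbardRingTV_pqgSectorEnergy_abs_hopping hL t₂,
    pqgSectorEnergy_tpencil, pqgSectorEnergy_tpencil]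
  have hc := concaveOn_pqgSectorEnergy_line
    (fun p q => (((hubbardRingTV L 0 U).h p q : ℚ) : ℂ)) (fun p q => (((hubbardRingTV L 1 0).h p q : ℚ) : ℂ))
    (fun p q r s => (((hubbardRingTV L 0 U).eri p q r s : ℚ) : ℂ))
    (fun p q r s => (((hubbardRingTV L 1 0).eri p q r s : ℚ) : ℂ))
    (((hubbardRingTV L 0 U).ecore : ℚ) : ℂ) (((hubbardRingTV L 1 0).ecore : ℚ) : ℂ)
    (a := a) (b := b) (by rwa [Fintype.card_fin]) (by rwa [Fintype.card_fin])
  have heven := hubbardRingTV_pqgSectorEnergy_neg_hopping hL |t₂| U a b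
  rw [pqgSectorEnergy_tpencil, pqgSectorEnergy_tpencil, Rat.cast_neg] at heven
  have h := le_of_concaveOn_univ_of_neg_eq hc (x := ((|t₁| : ℚ) : ℝ)) (y := ((|t₂| : ℚ) : ℝ))
    (by exact_mod_cast abs_nonneg t₁) (by exact_mod_cast h12) (by exact_mod_cast heven)
  exact_mod_cast h

/-- **THE SINGLET-RESTRICTED (`⟨Ŝ²⟩ = 0`) DQG LOWER BOUND OF AN EVEN RING IS NON-INCREASING IN `|t|`**:
for `Even L`, `n ≤ L` and `|t₁| ≤ |t₂|`,
`OPT_DQG+S²(hubbardRingTV L t₂ U; n) ≤ OPT_DQG+S²(hubbardRingTV L t₁ U; n)`. -/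
theorem hubbardRingTV_pqgSingletEnergy_anti_abs {L : ℕ} (hL : Even L) {n : ℕ} (hn : n ≤ L)
    (U : ℚ) {t₁ t₂ : ℚ} (h12 : |t₁| ≤ |t₂|) :
    Model.pqgSingletEnergy (hubbardRingTV L t₂ U) n ≤ Model.pqgSingletEnergy (hubbardRingTV L t₁ U) n := by
  rw [← hubbardRingTV_pqgSingletEnergy_abs_hopping hL t₁, ← hubbardRingTV_pqgSingletEnergy_abs_hopping hL t₂,
    pqgSingletEnergy_tpencil, pqgSingletEnergy_tpencil]
  have hc := concaveOn_pqgSingletEnergy_line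
    (fun p q => (((hubbardRingTV L 0 U).h p q : ℚ) : ℂ)) (fun p q => (((hubbardRingTV L 1 0).h p q : ℚ) : ℂ))
    (fun p q r s => (((hubbardRingTV L 0 U).eri p q r s : ℚ) : ℂ))
    (fun p q r s => (((hubbardRingTV L 1 0).eri p q r s : ℚ) : ℂ))
    (((hubbardRingTV L 0 U).ecore : ℚ) : ℂ) (((hubbardRingTV L 1 0).ecore : ℚ) : ℂ)
    (n := n) (by rwa [Fintype.card_fin])
  have heven := hubbardRingTV_pqgSingletEnergy_neg_hopping hL |t₂| U n
  rw [pqgSingletEnergy_tpencil, pqgSingletEnergy_tpencil, Rat.cast_neg] at heven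
  have h := le_of_concaveOn_univ_of_neg_eq hc (x := ((|t₁| : ℚ) : ℝ)) (y := ((|t₂| : ℚ) : ℝ))
    (by exact_mod_cast abs_nonneg t₁) (by exact_mod_cast h12) (by exact_mod_cast heven)
  exact_mod_cast h

/-- **THE EXACT SECTOR ENERGY OF AN EVEN RING IS NON-INCREASING IN `|t|`**: for `Even L`, `a, b ≤ L`
and `|t₁| ≤ |t₂|`, `E₀(hubbardRingTV L t₂ U; a, b) ≤ E₀(hubbardRingTV L t₁ U; a, b)`. -/
theorem hubbardRingTV_energy_anti_abs {L : ℕ} (hL : Even L) {a b : ℕ} (ha : a ≤ L) (hb : b ≤ L)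
    (U : ℚ) {t₁ t₂ : ℚ} (h12 : |t₁| ≤ |t₂|) :
    Model.energy (hubbardRingTV L t₂ U) a b ≤ Model.energy (hubbardRingTV L t₁ U) a b := by
  rw [← hubbardRingTV_energy_abs_hopping hL t₁, ← hubbardRingTV_energy_abs_hopping hL t₂,
    energy_tpencil, energy_tpencil]
  have hc := concaveOn_sectorGroundEnergy_line
    (fun p q => (((hubbardRingTV L 0 U).h p q : ℚ) : ℂ)) (fun p q => (((hubbardRingTV L 1 0).h p q : ℚ) : ℂ))
    (fun p q r s => (((hubbardRingTV L 0 U).eri p q r s : ℚ) : ℂ))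
    (fun p q r s => (((hubbardRingTV L 1 0).eri p q r s : ℚ) : ℂ))
    (((hubbardRingTV L 0 U).ecore : ℚ) : ℂ) (((hubbardRingTV L 1 0).ecore : ℚ) : ℂ)
    (a := a) (b := b) (by rwa [Fintype.card_fin]) (by rwa [Fintype.card_fin])
  have heven := hubbardRingTV_energy_neg_hopping hL |t₂| U a b
  rw [energy_tpencil, energy_tpencil, Rat.cast_neg] at heven
  have h := le_of_concaveOn_univ_of_neg_eq hc (x := ((|t₁| : ℚ) : ℝ)) (y := ((|t₂| : ℚ) : ℝ))
    (by exact_mod_cast abs_nonneg t₁) (by exact_mod_cast h12) (by exact_mod_cast heven)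
  exact_mod_cast h

/-- **Hopping of either sign lowers the sector DQG bound**: `OPT_DQG(L; t, U) ≤ OPT_DQG(L; 0, U)`
(`Even L`, `a, b ≤ L`). -/
theorem hubbardRingTV_pqgSectorEnergy_le_zero_hopping {L : ℕ} (hL : Even L) {a b : ℕ} (ha : a ≤ L)
    (hb : b ≤ L) (t U : ℚ) :
    Model.pqgSectorEnergy (hubbardRingTV L t U) a b ≤ Model.pqgSectorEnergy (hubbardRingTV L 0 U) a b :=
  hubbardRingTV_pqgSectorEnergy_anti_abs hL ha hb U (by rw [abs_zero]; exact abs_nonneg t)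

/-- **Hopping of either sign lowers the singlet DQG bound**: `OPT_DQG+S²(L; t, U) ≤ OPT_DQG+S²(L; 0, U)`
(`Even L`, `n ≤ L`). -/
theorem hubbardRingTV_pqgSingletEnergy_le_zero_hopping {L : ℕ} (hL : Even L) {n : ℕ} (hn : n ≤ L)
    (t U : ℚ) :
    Model.pqgSingletEnergy (hubbardRingTV L t U) n ≤ Model.pqgSingletEnergy (hubbardRingTV L 0 U) n :=
  hubbardRingTV_pqgSingletEnergy_anti_abs hL hn U (by rw [abs_zero]; exact abs_nonneg t)

/-- **Hopping of either sign lowers the exact sector energy**: `E₀(L; t, U) ≤ E₀(L; 0, U)`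
(`Even L`, `a, b ≤ L`). -/
theorem hubbardRingTV_energy_le_zero_hopping {L : ℕ} (hL : Even L) {a b : ℕ} (ha : a ≤ L) (hb : b ≤ L)
    (t U : ℚ) :
    Model.energy (hubbardRingTV L t U) a b ≤ Model.energy (hubbardRingTV L 0 U) a b :=
  hubbardRingTV_energy_anti_abs hL ha hb U (by rw [abs_zero]; exact abs_nonneg t)

end Summit.Ventures.CertifiedQuantumChemistry

end
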